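import Literature.MathematicalPhysics.QuantumLattice.SpinChargeTransportLocality
import Literature.MathematicalPhysics.QuantumLattice.ChargeTransportIndex
import HarnessLib

/-!
# The charge-transport index for a strict translation symmetry of a spin-`1/2` system:
# Lieb–Schultz–Mattis via Bachmann–Bols–De Roeck–Fraas with a Gaussian dressing

Spin analogue (sub-namespace `SpinLSM`) of the tree's fermionic `ChargeTransportIndex`: the
Lieb–Schultz–Mattis case (§3.2, Example 2) of S. Bachmann, A. Bols, W. De Roeck, M. Fraas,
*A many-body index for quantum charge transport*, Comm. Math. Phys. **375** (2019) 1249 (BBDF),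
Theorem 2.1 with Proposition 2.4, for a finite spin-`1/2` system on an arbitrary finite site set `Λ`
with a coordinate `coord : Λ → ℤ/L`, a `U(1)`-invariant local interaction `Φ` of coordinate range
`r₀` (`SpinLSM.IsCoordLocal`), and a unit translation `f : Λ ≃ Λ` (`coord ∘ f = coord + 1`) whose
permutation unitary `permOp f` commutes with `H = Σ_Z Φ Z`. The quasi-adiabatic dressings are the
GAUSSIAN ones of Hastings (PRB 69 (2004) 104431, §II): `K = i𝓖_a^{H_B}(J)` (`kLocG`), so that the
ground state is only an APPROXIMATE eigenvector of the dressed charge, with a spectral error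
`e^{-γ²/(4a)} |slab Γ|` that is traded against Gaussian-in-time locality — this is what gives the
`C log L / L` rate of the higher-dimensional Lieb–Schultz–Mattis theorem (Hastings 2004;
Nachtergaele–Sims, CMP 276 (2007)). Everything is PROVED; no named fact is introduced.

* `Setting` — the data and hypotheses (interaction, `U(1)`, translation, gap `g`, unique ground
  state `ψ`, Gaussian rate `a > 0`, and the scales: coordinate range `r₀ ≥ 1`, ball radius `r`,
  strip radius `m`, half-space height `h` with `r₀ ≤ r ≤ m`, `4r₀ + 2m + 1 ≤ h`,
  `h + 2r₀ + 2m + 2 ≤ L`).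
* The operators (BBDF (4.5)–(4.6)): windows `W₋ = [-r₀, 2r₀)`, `W₊ = [h-2r₀, h+r₀)`
  (`crossingTerms_subset_windows`: every term crossing `∂[0,h)` lies in one of them), balls
  `B± ⊇ W±` of margin `r`, strips `S± ⊇ B±` of margin `m`; `kM, kP` (local Gaussian dressings of
  the two window currents), `kTM, kTP` (global ones), `qBar = Q_Γ - K₋ - K₊ = qBarM + qMid + qBarP`,
  the translates `qBarMU, qBarPU`, `transV = permOp f`.
* `eucNorm_qBar_sub_le` — `‖(Q̄ - q̄)ψ‖₂ ≤ 2δ_K + e^{-γ²/(4a)} |slab Γ|`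
  (`δ_K = ‖K₋ - K̃₋‖ + ‖K₊ - K̃₊‖`);
  `strip_clustering` — BBDF Assumption (v) between the strips (`coord_clustering`);
  `expect_dM` — `⟨Q̄₋^U - Q̄₋⟩ = -⟨Q_{[0]}⟩`; `transV_conj_exp_two_pi_qBarM` — `V e^{2πiQ̄₋} Vᴴ = e^{2πiQ̄₋^U}`.
* `exists_int_abs_expect_plane_sub_le` — **the index theorem**: `ρ₀ = ⟨ψ, Q_{slab [0]} ψ⟩`
  satisfies `dist(ρ₀, ℤ) ≤ (2π((8πε + δ)‖D₋‖) + 2√(4πε+2δ) + 4πε + 2δ)/4` with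
  `ε = 2δ_K + e^{-γ²/(4a)} |slab Γ|` and `δ` the strip clustering constant, by the abstract
  exact-symmetry index theorem `exists_int_abs_expect_sub_le_of_exact_symmetry`
  (`ChargeIndexExactSymmetry`, BBDF §4).

The `O(·)` bookkeeping in the regime `h = L/2`, `m = L/8`, `r = L/16`, `a = γ/L` (errors
`poly(L)·e^{-cγL}`) and the torus `ℤ/L × ℤ/W` are in the sequel files.

## References

* S. Bachmann, A. Bols, W. De Roeck, M. Fraas, Comm. Math. Phys. **375** (2019) 1249–1272,
  arXiv:1810.07351: Theorem 2.1, Proposition 2.4, §3.2 (Example 2), §4. [BachmannEtAl2019]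
* M. B. Hastings, Phys. Rev. B **69** (2004) 104431, §II–III. [HastingsPRB2004]
* B. Nachtergaele, R. Sims, Comm. Math. Phys. **276** (2007) 437. [NachtergaeleSimsCMP2007]
* The tree: `SpinChargeTransportLocality` (`SpinLSM.IsCoordLocal`, `coord_clustering`,
  `windowCurrent`, `kLocG`, `kTildeG`, `eucNorm_regionCharge_sub_kTildeG_mulVec_le`,
  `norm_kLocG_sub_kTildeG_le`), `SpinChargeKinematics` (`permOp`, `regionCharge`,
  `exp_two_pi_I_smul_regionCharge`, `expect_permOp_conj`), `ChargeTransportIndex` (the cyclic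
  interval lemmas `zrange_add_period`, `zrange_subset_zrange`, `le_circDist_of_not_mem_ball`,
  `le_circDist_of_mem_zrange`), `CoordinateSlabs` (`cslab`, `zrange`, `map_cslab`),
  `ChargeIndexExactSymmetry` (`exists_int_abs_expect_sub_le_of_exact_symmetry`).
-/

noncomputable section

namespace Literature.MathematicalPhysics.QuantumLattice

open Matrix Complex Finset
open scoped Matrix.Norms.L2Operator ComplexOrder

namespace SpinLSM

section IndexSetting

variable {Λ : Type*} [Fintype Λ] [DecidableEq Λ] {L : ℕ}
variable (coord : Λ → ZMod L) (f : Λ ≃ Λ) (Φ : Interaction Λ 2) (r₀ V : ℕ) (J a : ℝ) (h m r : ℕ)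

/-- **The data and hypotheses of the spin Lieb–Schultz–Mattis index argument** (BBDF §4 with the
unitary `U` = the unit translation, §3.2, and Hastings' Gaussian dressing): a `U(1)`-invariant
local interaction of coordinate range `r₀ ≥ 1`, a unit translation that is a symmetry of
`H = Σ_Z Φ Z` and acts transitively on the coordinate, a spectral gap `g > 0` with unique
normalised ground state `ψ`, a Gaussian rate `a > 0`, and the scales `r₀ ≤ r ≤ m` of the
windows/balls/strips with `4r₀ + 2m + 1 ≤ h` and `h + 2r₀ + 2m + 2 ≤ L`.
[cite: BachmannEtAl2019, §2.1.1 and §4] -/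
structure Setting (g : ℝ) (ψ : TensorIndex Λ 2 → ℂ) : Prop where
  coordLocal : IsCoordLocal coord Φ r₀ V J
  u1 : ∀ Z, Commute (Φ Z) (regionCharge Z)
  shift : ∀ x, coord (f x) = coord x + 1
  surj : ∀ c : ZMod L, ∃ x, coord x = c
  symm : permOp f * localHamiltonian Φ univ = localHamiltonian Φ univ * permOp f
  a_pos : 0 < a
  gap_pos : 0 < g
  gap : (localHamiltonian Φ univ).HasSpectralGap g
  ground : (localHamiltonian Φ univ).IsGroundStateVector ψ
  unit : star ψ ⬝ᵥ ψ = 1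
  one_le_r₀ : 1 ≤ r₀
  r₀_le_r : r₀ ≤ r
  r_le_m : r ≤ m
  h_ge : 4 * r₀ + 2 * m + 1 ≤ h
  h_le : h + 2 * r₀ + 2 * m + 2 ≤ L

/-! #### The intervals -/

/-- The window `W₋ = [-r₀, 2r₀)` at the boundary `0` of `Γ = [0,h)`. [folklore] -/
def winM : Finset (ZMod L) := zrange (L - r₀) (3 * r₀)
/-- The window `W₊ = [h-2r₀, h+r₀)` at the boundary `h` of `Γ`. [folklore] -/
def winP : Finset (ZMod L) := zrange (h - 2 * r₀) (3 * r₀)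
/-- The ball `B₋ = [-r₀-r, 2r₀+r)` around `W₋`. [folklore] -/
def ballM : Finset (ZMod L) := zrange (L - r₀ - r) (3 * r₀ + 2 * r)
/-- The ball `B₊ = [h-2r₀-r, h+r₀+r)` around `W₊`. [folklore] -/
def ballP : Finset (ZMod L) := zrange (h - 2 * r₀ - r) (3 * r₀ + 2 * r)
/-- The strip `S₋ = [-r₀-m, 2r₀+m+1)` around `B₋`. [folklore] -/
def stripM : Finset (ZMod L) := zrange (L - r₀ - m) (3 * r₀ + 2 * m + 1)
/-- The strip `S₊ = [h-2r₀-m, h+r₀+m+1)` around `B₊`. [folklore] -/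
def stripP : Finset (ZMod L) := zrange (h - 2 * r₀ - m) (3 * r₀ + 2 * m + 1)

/-! #### The operators -/

/-- The translation unitary `V = permOp f` (BBDF's `U⋆` acts as `V · Vᴴ`). [folklore] -/
def transV : Op Λ 2 := permOp f

/-- `K₋ = i𝓖_a^{H_{B₋}}(J₋)`, `J₋ = J(Γ, W₋)`. [cite: BachmannEtAl2019, Proposition 2.4] -/
def kM : Op Λ 2 := kLocG a Φ (cslab coord (zrange 0 h)) (cslab coord (winM r₀)) (cslab coord (ballM r₀ r))

/-- `K₊ = i𝓖_a^{H_{B₊}}(J₊)`, `J₊ = J(Γ, W₊)`. [cite: BachmannEtAl2019, Proposition 2.4] -/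
def kP : Op Λ 2 := kLocG a Φ (cslab coord (zrange 0 h)) (cslab coord (winP r₀ h)) (cslab coord (ballP r₀ h r))

/-- `K̃₋ = i𝓖_a^{H}(J₋)`. [cite: BachmannEtAl2019, Proposition 2.4] -/
def kTM : Op Λ 2 := kTildeG a Φ (cslab coord (zrange 0 h)) (cslab coord (winM r₀))

/-- `K̃₊ = i𝓖_a^{H}(J₊)`. [cite: BachmannEtAl2019, Proposition 2.4] -/
def kTP : Op Λ 2 := kTildeG a Φ (cslab coord (zrange 0 h)) (cslab coord (winP r₀ h))

/-- `Q̄ = Q_Γ - K₋ - K₊` (BBDF Lemma 4.4). [cite: BachmannEtAl2019, Lemma 4.4] -/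
def qBar : Op Λ 2 := regionCharge (cslab coord (zrange 0 h)) - kM coord Φ r₀ a h r - kP coord Φ r₀ a h r

/-- `Q̄₋ = Q_{[0, 2r₀+m]} - K₋` (BBDF (4.5)). [cite: BachmannEtAl2019, Eq. (4.5)] -/
def qBarM : Op Λ 2 := regionCharge (cslab coord (zrange 0 (2 * r₀ + m + 1))) - kM coord Φ r₀ a h r

/-- `Q_m = Q_{[2r₀+m+1, h-2r₀-m)}` (BBDF (4.5)). [cite: BachmannEtAl2019, Eq. (4.5)] -/
def qMid : Op Λ 2 := regionCharge (cslab coord (zrange (2 * r₀ + m + 1) (h - 4 * r₀ - 2 * m - 1)))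

/-- `Q̄₊ = Q_{[h-2r₀-m, h)} - K₊` (BBDF (4.5)). [cite: BachmannEtAl2019, Eq. (4.5)] -/
def qBarP : Op Λ 2 := regionCharge (cslab coord (zrange (h - 2 * r₀ - m) (2 * r₀ + m))) - kP coord Φ r₀ a h r

/-- `Q̄₋^U = Q_{[1, 2r₀+m]} - V K₋ Vᴴ` (BBDF (4.6) with `T₋ = -Q_{[0]}`). [cite: BachmannEtAl2019, Eq. (4.6)] -/
def qBarMU : Op Λ 2 :=
  regionCharge (cslab coord (zrange 1 (2 * r₀ + m))) - transV f * kM coord Φ r₀ a h r * (transV f)ᴴ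

/-- `Q̄₊^U = Q_{[h-2r₀-m, h]} - V K₊ Vᴴ` (BBDF (4.6) with `T₊ = Q_{[h]}`). [cite: BachmannEtAl2019, Eq. (4.6)] -/
def qBarPU : Op Λ 2 :=
  regionCharge (cslab coord (zrange (h - 2 * r₀ - m) (2 * r₀ + m + 1))) - transV f * kP coord Φ r₀ a h r * (transV f)ᴴ

/-! #### Geometry of the intervals -/

section Geometry

variable {coord f Φ r₀ V J a h m r} {g : ℝ} {ψ : TensorIndex Λ 2 → ℂ}

local notation "𝔖" => Setting coord f Φ r₀ V J a h m r g ψ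

/-- The cyclic ball of radius `ρ` around `c`: if `circDist a c ≤ ρ` then
`a ∈ [c-ρ, c+ρ] = zrange (c + (L - ρ)) (2ρ+1)` (`2ρ+1 ≤ L`). [folklore] -/
theorem mem_ball_of_circDist_le [NeZero L] {c ρ : ℕ} (hρ : 2 * ρ + 1 ≤ L) {a : ZMod L}
    (ha : circDist a (c : ℕ) ≤ ρ) : a ∈ (zrange (c + (L - ρ)) (2 * ρ + 1) : Finset (ZMod L)) := by
  by_contra hmem
  have := le_circDist_of_not_mem_ball hρ hmem
  omega

/-- **The terms crossing the boundary of `Γ = [0,h)` lie in the two windows** (BBDF §3.2: charge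
leaves `Γ` only across its two boundary planes): a region of coordinate diameter `≤ r₀` meeting
both `Γ` and its complement has all its coordinates in `W₋ = [-r₀, 2r₀)` or in
`W₊ = [h-2r₀, h+r₀)`. [cite: BachmannEtAl2019, §3.2] -/
theorem crossingTerms_subset_windows [NeZero L] (hs : 𝔖) :
    ∀ Z ∈ crossingTerms (cslab coord (zrange 0 h)), Φ Z ≠ 0 →
      Z ⊆ cslab coord (winM r₀) ∨ Z ⊆ cslab coord (winP r₀ h) := by
  have h1 := hs.one_le_r₀; have hge := hs.h_ge; have hle := hs.h_le
  intro Z hZ hΦZ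
  obtain ⟨hnsub, hndisj⟩ := mem_crossingTerms.1 hZ
  obtain ⟨z₁, hz₁Z, hz₁⟩ := Finset.not_disjoint_iff.1 hndisj
  obtain ⟨z₂, hz₂Z, hz₂⟩ := Finset.not_subset.1 hnsub
  rw [mem_cslab] at hz₁ hz₂
  obtain ⟨k, hk, hk₁⟩ := mem_zrange.1 hz₁
  rw [zero_add] at hk₁
  -- every coordinate of `Z` is in the ball of radius `r₀` around `k`
  have hball : ∀ z ∈ Z, coord z ∈ (zrange (k + (L - r₀)) (2 * r₀ + 1) : Finset (ZMod L)) := by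
    intro z hz
    refine mem_ball_of_circDist_le (by omega) ?_
    rw [← hk₁]
    exact hs.coordLocal.range Z hΦZ z hz z₁ hz₁Z
  -- three cases for `k`
  rcases Nat.lt_or_ge k r₀ with hk0 | hk0
  · -- near `0`: the ball lies in `W₋`
    left
    intro z hz
    rw [mem_cslab]
    have hsub : (zrange (k + (L - r₀)) (2 * r₀ + 1) : Finset (ZMod L)) ⊆ winM r₀ := by
      unfold winM
      exact zrange_subset_zrange (by omega) (by omega)
    exact hsub (hball z hz)
  rcases Nat.lt_or_ge k (h - r₀) with hkh | hkh
  · -- middle: the ball lies inside `Γ`, contradicting `z₂`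
    exfalso
    apply hz₂
    have hsub : (zrange (k + (L - r₀)) (2 * r₀ + 1) : Finset (ZMod L)) ⊆ zrange 0 h := by
      rw [show k + (L - r₀) = (k - r₀) + L by omega, zrange_add_period]
      exact zrange_subset_zrange (by omega) (by omega)
    exact hsub (hball z₂ hz₂Z)
  · -- near `h`: the ball lies in `W₊`
    right
    intro z hz
    rw [mem_cslab]
    have hsub : (zrange (k + (L - r₀)) (2 * r₀ + 1) : Finset (ZMod L)) ⊆ winP r₀ h := by
      rw [show k + (L - r₀) = (k - r₀) + L by omega, zrange_add_period]
      unfold winP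
      exact zrange_subset_zrange (by omega) (by omega)
    exact hsub (hball z hz)

/-- The two windows are disjoint. [folklore] -/
theorem disjoint_winM_winP (hs : 𝔖) : Disjoint (winM r₀ : Finset (ZMod L)) (winP r₀ h) := by
  have := hs.h_ge; have := hs.h_le
  unfold winM winP
  exact (disjoint_zrange_of_le (by omega) (by omega)).symm

/-- The window slabs are disjoint. [folklore] -/
theorem disjoint_cslab_win (hs : 𝔖) : Disjoint (cslab coord (winM r₀)) (cslab coord (winP r₀ h)) :=
  disjoint_cslab coord (disjoint_winM_winP hs)

/-- A point of `Z` outside the ball `B₋` is at distance `≥ r + 1` from every point of `W₋`; hence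
all of `Z` (diameter `≤ r₀`) is at distance `≥ r - r₀ + 1` from `W₋`. [folklore] -/
theorem ballM_separation [NeZero L] (hs : 𝔖) :
    ∀ Z, Φ Z ≠ 0 → ¬ Z ⊆ cslab coord (ballM r₀ r) →
      ∀ z ∈ Z, ∀ p ∈ cslab coord (winM r₀), r - r₀ + 1 ≤ circDist (coord z) (coord p) := by
  have h1 := hs.one_le_r₀; have hrr := hs.r₀_le_r; have hge := hs.h_ge; have hle := hs.h_le
  have hrm := hs.r_le_m
  intro Z hΦZ hZ z hz p hp
  obtain ⟨w, hwZ, hw⟩ := Finset.not_subset.1 hZ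
  rw [mem_cslab] at hw hp
  obtain ⟨j, hj, hpj⟩ := mem_zrange.1 hp
  -- `circDist (coord w) (coord p) ≥ r + 1`
  have hwp : r + 1 ≤ circDist (coord w) (coord p) := by
    by_contra hlt
    apply hw
    have hmem : coord w ∈ (zrange ((L - r₀ + j) + (L - r)) (2 * r + 1) : Finset (ZMod L)) :=
      mem_ball_of_circDist_le (by omega) (by rw [← hpj]; omega)
    have hsub : (zrange ((L - r₀ + j) + (L - r)) (2 * r + 1) : Finset (ZMod L)) ⊆ ballM r₀ r := by
      rw [show L - r₀ + j + (L - r) = (L - r₀ - r + j) + L by omega, zrange_add_period]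
      unfold ballM
      exact zrange_subset_zrange (by omega) (by omega)
    exact hsub hmem
  -- lose at most `r₀`
  have hzw : circDist (coord w) (coord p) ≤ circDist (coord w) (coord z) + circDist (coord z) (coord p) :=
    circDist_triangle _ _ _
  have hdiam := hs.coordLocal.range Z hΦZ w hwZ z hz
  omega

/-- The same for the ball `B₊` and the window `W₊`. [folklore] -/
theorem ballP_separation [NeZero L] (hs : 𝔖) :
    ∀ Z, Φ Z ≠ 0 → ¬ Z ⊆ cslab coord (ballP r₀ h r) →
      ∀ z ∈ Z, ∀ p ∈ cslab coord (winP r₀ h), r - r₀ + 1 ≤ circDist (coord z) (coord p) := by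
  have h1 := hs.one_le_r₀; have hrr := hs.r₀_le_r; have hge := hs.h_ge; have hle := hs.h_le
  have hrm := hs.r_le_m
  intro Z hΦZ hZ z hz p hp
  obtain ⟨w, hwZ, hw⟩ := Finset.not_subset.1 hZ
  rw [mem_cslab] at hw hp
  obtain ⟨j, hj, hpj⟩ := mem_zrange.1 hp
  have hwp : r + 1 ≤ circDist (coord w) (coord p) := by
    by_contra hlt
    apply hw
    have hmem : coord w ∈ (zrange ((h - 2 * r₀ + j) + (L - r)) (2 * r + 1) : Finset (ZMod L)) :=
      mem_ball_of_circDist_le (by omega) (by rw [← hpj]; omega)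
    have hsub : (zrange ((h - 2 * r₀ + j) + (L - r)) (2 * r + 1) : Finset (ZMod L)) ⊆ ballP r₀ h r := by
      rw [show h - 2 * r₀ + j + (L - r) = (h - 2 * r₀ - r + j) + L by omega, zrange_add_period]
      unfold ballP
      exact zrange_subset_zrange (by omega) (by omega)
    exact hsub hmem
  have hzw : circDist (coord w) (coord p) ≤ circDist (coord w) (coord z) + circDist (coord z) (coord p) :=
    circDist_triangle _ _ _
  have hdiam := hs.coordLocal.range Z hΦZ w hwZ z hz
  omega

/-- The windows are nonempty slabs (the coordinate is onto). [folklore] -/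
theorem cslab_winM_nonempty (hs : 𝔖) : (cslab coord (winM r₀)).Nonempty := by
  have h1 := hs.one_le_r₀
  obtain ⟨x, hx⟩ := hs.surj (((L - r₀ : ℕ) : ZMod L))
  exact ⟨x, by rw [mem_cslab, hx]; exact mem_zrange.2 ⟨0, by omega, by rw [add_zero]⟩⟩

/-- The windows are nonempty slabs. [folklore] -/
theorem cslab_winP_nonempty (hs : 𝔖) : (cslab coord (winP r₀ h)).Nonempty := by
  have h1 := hs.one_le_r₀
  obtain ⟨x, hx⟩ := hs.surj (((h - 2 * r₀ : ℕ) : ZMod L))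
  exact ⟨x, by rw [mem_cslab, hx]; exact mem_zrange.2 ⟨0, by omega, by rw [add_zero]⟩⟩

end Geometry

/-! #### Supports of the operators and their commutation -/

section Supports

variable {coord f Φ r₀ V J a h m r} {g : ℝ} {ψ : TensorIndex Λ 2 → ℂ}

local notation "𝔖" => Setting coord f Φ r₀ V J a h m r g ψ

/-- Operators of slabs over disjoint coordinate sets commute. [folklore] -/
theorem commute_of_mem_cslab {S T : Finset (ZMod L)} {A B : Op Λ 2}
    (hA : A ∈ supportedSubalgebra (cslab coord S)) (hB : B ∈ supportedSubalgebra (cslab coord T))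
    (hST : Disjoint S T) : Commute A B :=
  commute_of_mem_supportedSubalgebra (disjoint_cslab coord hST) hA hB

/-- Monotonicity of slab algebras in the coordinate set. [folklore] -/
theorem mem_of_subset {S T : Finset (ZMod L)} {A : Op Λ 2}
    (hA : A ∈ supportedSubalgebra (cslab coord S)) (hST : S ⊆ T) : A ∈ supportedSubalgebra (cslab coord T) :=
  supportedSubalgebra_mono (cslab_mono coord hST) hA

/-- `Q_{slab S} ∈ 𝔄(slab T)` for `S ⊆ T`. [folklore] -/
theorem regionCharge_cslab_mem {S T : Finset (ZMod L)} (hST : S ⊆ T) :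
    regionCharge (cslab coord S) ∈ supportedSubalgebra (cslab coord T) :=
  mem_of_subset (regionCharge_mem_supportedSubalgebra _) hST

/-- `W₋ ⊆ B₋`. [folklore] -/
theorem winM_subset_ballM (hs : 𝔖) : (winM r₀ : Finset (ZMod L)) ⊆ ballM r₀ r := by
  have := hs.h_le; have := hs.h_ge; have := hs.r_le_m
  unfold winM ballM; exact zrange_subset_zrange (by omega) (by omega)

/-- `W₊ ⊆ B₊`. [folklore] -/
theorem winP_subset_ballP (hs : 𝔖) : (winP r₀ h : Finset (ZMod L)) ⊆ ballP r₀ h r := by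
  have := hs.h_le; have := hs.h_ge; have := hs.r_le_m
  unfold winP ballP; exact zrange_subset_zrange (by omega) (by omega)

/-- `K₋ ∈ 𝔄(slab B₋)`. [folklore] -/
theorem kM_mem (hs : 𝔖) : kM coord Φ r₀ a h r ∈ supportedSubalgebra (cslab coord (ballM r₀ r)) :=
  kLocG_mem hs.coordLocal.isLocal a (cslab_mono coord (winM_subset_ballM hs))

/-- `K₊ ∈ 𝔄(slab B₊)`. [folklore] -/
theorem kP_mem (hs : 𝔖) : kP coord Φ r₀ a h r ∈ supportedSubalgebra (cslab coord (ballP r₀ h r)) :=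
  kLocG_mem hs.coordLocal.isLocal a (cslab_mono coord (winP_subset_ballP hs))

/-- `B₋ ⊆ S₋`. [folklore] -/
theorem ballM_subset_stripM (hs : 𝔖) : (ballM r₀ r : Finset (ZMod L)) ⊆ stripM r₀ m := by
  have := hs.r_le_m; have := hs.h_le; have := hs.h_ge
  unfold ballM stripM; exact zrange_subset_zrange (by omega) (by omega)

/-- `B₋ + 1 ⊆ S₋`. [folklore] -/
theorem ballM_add_one_subset_stripM (hs : 𝔖) :
    ((ballM r₀ r : Finset (ZMod L)).image fun x => x + 1) ⊆ stripM r₀ m := by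
  have := hs.r_le_m; have := hs.h_le; have := hs.h_ge
  unfold ballM stripM
  rw [image_add_one_zrange]
  exact zrange_subset_zrange (by omega) (by omega)

/-- `B₊ ⊆ S₊`. [folklore] -/
theorem ballP_subset_stripP (hs : 𝔖) : (ballP r₀ h r : Finset (ZMod L)) ⊆ stripP r₀ h m := by
  have := hs.r_le_m; have := hs.h_ge
  unfold ballP stripP; exact zrange_subset_zrange (by omega) (by omega)

/-- `B₊ + 1 ⊆ S₊`. [folklore] -/
theorem ballP_add_one_subset_stripP (hs : 𝔖) :
    ((ballP r₀ h r : Finset (ZMod L)).image fun x => x + 1) ⊆ stripP r₀ h m := by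
  have := hs.r_le_m; have := hs.h_ge
  unfold ballP stripP
  rw [image_add_one_zrange]
  exact zrange_subset_zrange (by omega) (by omega)

/-- `[0, 2r₀+m] ⊆ S₋` (through `[L, L+2r₀+m]`). [folklore] -/
theorem zrange_zero_subset_stripM (hs : 𝔖) : (zrange 0 (2 * r₀ + m + 1) : Finset (ZMod L)) ⊆ stripM r₀ m := by
  have := hs.h_le
  rw [← zrange_add_period 0 (2 * r₀ + m + 1)]
  unfold stripM; exact zrange_subset_zrange (by omega) (by omega)

/-- `[1, 2r₀+m] ⊆ S₋`. [folklore] -/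
theorem zrange_one_subset_stripM (hs : 𝔖) : (zrange 1 (2 * r₀ + m) : Finset (ZMod L)) ⊆ stripM r₀ m := by
  have := hs.h_le
  rw [← zrange_add_period 1 (2 * r₀ + m)]
  unfold stripM; exact zrange_subset_zrange (by omega) (by omega)

/-- `Q̄₋ ∈ 𝔄(slab S₋)`. [folklore] -/
theorem qBarM_mem (hs : 𝔖) : qBarM coord Φ r₀ a h m r ∈ supportedSubalgebra (cslab coord (stripM r₀ m)) :=
  Subalgebra.sub_mem _ (regionCharge_cslab_mem (zrange_zero_subset_stripM hs))
    (mem_of_subset (kM_mem hs) (ballM_subset_stripM hs))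

/-- `Q_m ∈ 𝔄(slab [2r₀+m+1, h-2r₀-m))`. [folklore] -/
theorem qMid_mem : qMid coord r₀ h m ∈
    supportedSubalgebra (cslab coord (zrange (2 * r₀ + m + 1) (h - 4 * r₀ - 2 * m - 1))) :=
  regionCharge_mem_supportedSubalgebra _

/-- `Q̄₊ ∈ 𝔄(slab S₊)`. [folklore] -/
theorem qBarP_mem (hs : 𝔖) : qBarP coord Φ r₀ a h m r ∈ supportedSubalgebra (cslab coord (stripP r₀ h m)) :=
  Subalgebra.sub_mem _ (regionCharge_cslab_mem (by unfold stripP; exact zrange_subset_zrange le_rfl (by omega)))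
    (mem_of_subset (kP_mem hs) (ballP_subset_stripP hs))

/-- Conjugating an element of a slab algebra by the translation lands in the shifted slab algebra.
[folklore] -/
theorem transV_conj_mem_cslab (hf : ∀ x : Λ, coord (f x) = coord x + 1) {S : Finset (ZMod L)} {A : Op Λ 2}
    (hA : A ∈ supportedSubalgebra (cslab coord S)) :
    transV f * A * (transV f)ᴴ ∈ supportedSubalgebra (cslab coord (S.image fun x => x + 1)) := by
  have h := permOp_conj_mem_supportedSubalgebra f hA
  rwa [map_cslab hf] at h

/-- `V K₋ Vᴴ ∈ 𝔄(slab (B₋ + 1))`. [folklore] -/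
theorem transV_kM_mem (hs : 𝔖) : transV f * kM coord Φ r₀ a h r * (transV f)ᴴ ∈
    supportedSubalgebra (cslab coord ((ballM r₀ r : Finset (ZMod L)).image fun x => x + 1)) :=
  transV_conj_mem_cslab hs.shift (kM_mem hs)

/-- `V K₊ Vᴴ ∈ 𝔄(slab (B₊ + 1))`. [folklore] -/
theorem transV_kP_mem (hs : 𝔖) : transV f * kP coord Φ r₀ a h r * (transV f)ᴴ ∈
    supportedSubalgebra (cslab coord ((ballP r₀ h r : Finset (ZMod L)).image fun x => x + 1)) :=
  transV_conj_mem_cslab hs.shift (kP_mem hs)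

/-- `Q̄₋^U ∈ 𝔄(slab S₋)`. [folklore] -/
theorem qBarMU_mem (hs : 𝔖) : qBarMU coord f Φ r₀ a h m r ∈ supportedSubalgebra (cslab coord (stripM r₀ m)) :=
  Subalgebra.sub_mem _ (regionCharge_cslab_mem (zrange_one_subset_stripM hs))
    (mem_of_subset (transV_kM_mem hs) (ballM_add_one_subset_stripM hs))

/-- `Q̄₊^U ∈ 𝔄(slab S₊)`. [folklore] -/
theorem qBarPU_mem (hs : 𝔖) : qBarPU coord f Φ r₀ a h m r ∈ supportedSubalgebra (cslab coord (stripP r₀ h m)) :=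
  Subalgebra.sub_mem _ (regionCharge_cslab_mem (by unfold stripP; exact zrange_subset_zrange le_rfl (by omega)))
    (mem_of_subset (transV_kP_mem hs) (ballP_add_one_subset_stripP hs))

/-- `S₋ ∩ [2r₀+m+1, h-2r₀-m) = ∅`. [folklore] -/
theorem disjoint_stripM_mid (hs : 𝔖) :
    Disjoint (stripM r₀ m : Finset (ZMod L)) (zrange (2 * r₀ + m + 1) (h - 4 * r₀ - 2 * m - 1)) := by
  have := hs.h_le; have := hs.h_ge
  unfold stripM
  rw [← zrange_add_period (2 * r₀ + m + 1)]
  exact disjoint_zrange_of_le (by omega) (by omega)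

/-- `[2r₀+m+1, h-2r₀-m) ∩ S₊ = ∅`. [folklore] -/
theorem disjoint_mid_stripP (hs : 𝔖) :
    Disjoint (zrange (2 * r₀ + m + 1) (h - 4 * r₀ - 2 * m - 1) : Finset (ZMod L)) (stripP r₀ h m) := by
  have := hs.h_le; have := hs.h_ge
  unfold stripP
  exact disjoint_zrange_of_le (by omega) (by omega)

/-- `S₊ ∩ S₋ = ∅`. [folklore] -/
theorem disjoint_stripP_stripM (hs : 𝔖) : Disjoint (stripP r₀ h m : Finset (ZMod L)) (stripM r₀ m) := by
  have := hs.h_le; have := hs.h_ge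
  unfold stripP stripM
  exact disjoint_zrange_of_le (by omega) (by omega)

end Supports

/-! #### The decompositions `Q̄ = Q̄₋ + Q_m + Q̄₊` and `V Q̄ Vᴴ = Q̄₋^U + Q_m + Q̄₊^U` -/

section Identities

variable {coord f Φ r₀ V J a h m r} {g : ℝ} {ψ : TensorIndex Λ 2 → ℂ}

local notation "𝔖" => Setting coord f Φ r₀ V J a h m r g ψ

/-- Charges of slabs over disjoint coordinate sets add. [folklore] -/
theorem regionCharge_cslab_union {S T : Finset (ZMod L)} (hST : Disjoint S T) :
    regionCharge (cslab coord (S ∪ T)) = regionCharge (cslab coord S) + regionCharge (cslab coord T) := by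
  rw [cslab_union, regionCharge_union (disjoint_cslab coord hST)]

/-- **BBDF (4.5)**: `Q̄ = Q̄₋ + Q_m + Q̄₊`. [cite: BachmannEtAl2019, Eq. (4.5)] -/
theorem qBar_eq (hs : 𝔖) : qBar coord Φ r₀ a h r =
    qBarM coord Φ r₀ a h m r + qMid coord r₀ h m + qBarP coord Φ r₀ a h m r := by
  have hge := hs.h_ge; have hle := hs.h_le
  have e1 : (zrange 0 h : Finset (ZMod L)) = zrange 0 (2 * r₀ + m + 1) ∪ zrange (2 * r₀ + m + 1) (h - (2 * r₀ + m + 1)) := by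
    conv_lhs => rw [show h = (2 * r₀ + m + 1) + (h - (2 * r₀ + m + 1)) by omega]
    rw [zrange_add, zero_add]
  have e2 : (zrange (2 * r₀ + m + 1) (h - (2 * r₀ + m + 1)) : Finset (ZMod L)) =
      zrange (2 * r₀ + m + 1) (h - 4 * r₀ - 2 * m - 1) ∪ zrange (h - 2 * r₀ - m) (2 * r₀ + m) := by
    conv_lhs => rw [show h - (2 * r₀ + m + 1) = (h - 4 * r₀ - 2 * m - 1) + (2 * r₀ + m) by omega]
    rw [zrange_add, show 2 * r₀ + m + 1 + (h - 4 * r₀ - 2 * m - 1) = h - 2 * r₀ - m by omega]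
  have d1 : Disjoint (zrange 0 (2 * r₀ + m + 1) : Finset (ZMod L)) (zrange (2 * r₀ + m + 1) (h - (2 * r₀ + m + 1))) :=
    disjoint_zrange_of_le (by omega) (by omega)
  have d2 : Disjoint (zrange (2 * r₀ + m + 1) (h - 4 * r₀ - 2 * m - 1) : Finset (ZMod L)) (zrange (h - 2 * r₀ - m) (2 * r₀ + m)) :=
    disjoint_zrange_of_le (by omega) (by omega)
  unfold qBar qBarM qMid qBarP
  rw [e1, regionCharge_cslab_union d1, e2, regionCharge_cslab_union d2]
  abel

/-- `V Q_{slab [a, a+n)} Vᴴ = Q_{slab [a+1, a+1+n)}`. [folklore] -/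
theorem transV_conj_regionCharge_zrange (hs : 𝔖) (b n : ℕ) :
    transV f * regionCharge (cslab coord (zrange b n)) * (transV f)ᴴ = regionCharge (cslab coord (zrange (b + 1) n)) := by
  rw [transV, permOp_mul_regionCharge_mul_conjTranspose, map_cslab hs.shift, image_add_one_zrange]

/-- **BBDF (4.6) conjugated**: `V Q̄ Vᴴ = Q̄₋^U + Q_m + Q̄₊^U` (exactly: `V Q_Γ Vᴴ - Q_Γ = -Q_{[0]} + Q_{[h]}`,
BBDF §3.2). [cite: BachmannEtAl2019, Eq. (4.6) and §3.2] -/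
theorem transV_conj_qBar (hs : 𝔖) : transV f * qBar coord Φ r₀ a h r * (transV f)ᴴ =
    qBarMU coord f Φ r₀ a h m r + qMid coord r₀ h m + qBarPU coord f Φ r₀ a h m r := by
  have hge := hs.h_ge; have hle := hs.h_le
  have e1 : (zrange 1 h : Finset (ZMod L)) = zrange 1 (2 * r₀ + m) ∪ zrange (2 * r₀ + m + 1) (h - (2 * r₀ + m)) := by
    conv_lhs => rw [show h = (2 * r₀ + m) + (h - (2 * r₀ + m)) by omega]
    rw [zrange_add, show 1 + (2 * r₀ + m) = 2 * r₀ + m + 1 by omega]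
  have e2 : (zrange (2 * r₀ + m + 1) (h - (2 * r₀ + m)) : Finset (ZMod L)) =
      zrange (2 * r₀ + m + 1) (h - 4 * r₀ - 2 * m - 1) ∪ zrange (h - 2 * r₀ - m) (2 * r₀ + m + 1) := by
    conv_lhs => rw [show h - (2 * r₀ + m) = (h - 4 * r₀ - 2 * m - 1) + (2 * r₀ + m + 1) by omega]
    rw [zrange_add, show 2 * r₀ + m + 1 + (h - 4 * r₀ - 2 * m - 1) = h - 2 * r₀ - m by omega]
  have d1 : Disjoint (zrange 1 (2 * r₀ + m) : Finset (ZMod L)) (zrange (2 * r₀ + m + 1) (h - (2 * r₀ + m))) :=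
    disjoint_zrange_of_le (by omega) (by omega)
  have d2 : Disjoint (zrange (2 * r₀ + m + 1) (h - 4 * r₀ - 2 * m - 1) : Finset (ZMod L)) (zrange (h - 2 * r₀ - m) (2 * r₀ + m + 1)) :=
    disjoint_zrange_of_le (by omega) (by omega)
  unfold qBar qBarMU qMid qBarPU
  rw [Matrix.mul_sub, Matrix.mul_sub, Matrix.sub_mul, Matrix.sub_mul, transV_conj_regionCharge_zrange hs, zero_add,
    e1, regionCharge_cslab_union d1, e2, regionCharge_cslab_union d2]
  abel

/-! #### Commutation of operators on the three strips -/

/-- `[Q̄₋, Q_m] = 0`. [folklore] -/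
theorem commute_qBarM_qMid (hs : 𝔖) : Commute (qBarM coord Φ r₀ a h m r) (qMid coord r₀ h m) :=
  commute_of_mem_cslab (qBarM_mem hs) qMid_mem (disjoint_stripM_mid hs)

/-- `[Q̄₋, Q̄₊] = 0`. [folklore] -/
theorem commute_qBarM_qBarP (hs : 𝔖) : Commute (qBarM coord Φ r₀ a h m r) (qBarP coord Φ r₀ a h m r) :=
  commute_of_mem_cslab (qBarM_mem hs) (qBarP_mem hs) (disjoint_stripP_stripM hs).symm

/-- `[Q_m, Q̄₊] = 0`. [folklore] -/
theorem commute_qMid_qBarP (hs : 𝔖) : Commute (qMid coord r₀ h m) (qBarP coord Φ r₀ a h m r) :=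
  commute_of_mem_cslab qMid_mem (qBarP_mem hs) (disjoint_mid_stripP hs)

/-- `[Q̄₋^U, Q_m] = 0`. [folklore] -/
theorem commute_qBarMU_qMid (hs : 𝔖) : Commute (qBarMU coord f Φ r₀ a h m r) (qMid coord r₀ h m) :=
  commute_of_mem_cslab (qBarMU_mem hs) qMid_mem (disjoint_stripM_mid hs)

/-- `[Q̄₋^U, Q̄₊^U] = 0`. [folklore] -/
theorem commute_qBarMU_qBarPU (hs : 𝔖) : Commute (qBarMU coord f Φ r₀ a h m r) (qBarPU coord f Φ r₀ a h m r) :=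
  commute_of_mem_cslab (qBarMU_mem hs) (qBarPU_mem hs) (disjoint_stripP_stripM hs).symm

/-- `[Q_m, Q̄₊^U] = 0`. [folklore] -/
theorem commute_qMid_qBarPU (hs : 𝔖) : Commute (qMid coord r₀ h m) (qBarPU coord f Φ r₀ a h m r) :=
  commute_of_mem_cslab qMid_mem (qBarPU_mem hs) (disjoint_mid_stripP hs)

/-! #### Conjugating exponentials by the translation -/

/-- **The translation conjugates exponentials**: `V e^{cX} Vᴴ = e^{c VXVᴴ}`. [folklore] -/
theorem transV_conj_exp (c : ℂ) (X : Op Λ 2) :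
    transV f * NormedSpace.exp (c • X) * (transV f)ᴴ = NormedSpace.exp (c • (transV f * X * (transV f)ᴴ)) := by
  unfold transV
  have hU : ((permOp f : Op Λ 2)ᴴ)ᴴ * (permOp f)ᴴ = 1 := by
    rw [conjTranspose_conjTranspose, permOp_mul_conjTranspose]
  have h := conjTranspose_mul_exp_mul hU (c • X)
  rw [conjTranspose_conjTranspose] at h
  rw [h, Matrix.mul_smul, Matrix.smul_mul]

end Identities

/-! #### The small quantities: `δ_K`, the spectral error `ε_s`, the expectation `q̄` -/

section Quantities

/-- `δ_K = ‖K₋ - K̃₋‖ + ‖K₊ - K̃₊‖`. [folklore] -/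
def deltaK : ℝ :=
  ‖kM coord Φ r₀ a h r - kTM coord Φ r₀ a h‖ + ‖kP coord Φ r₀ a h r - kTP coord Φ r₀ a h‖

/-- `δ_K ≥ 0`. [folklore] -/
theorem deltaK_nonneg : 0 ≤ deltaK coord Φ r₀ a h r := by unfold deltaK; positivity

/-- The spectral error `ε_s = e^{-g²/(4a)} |slab Γ|` of the Gaussian dressing (Hastings 2004 §II).
[folklore] -/
def epsSpec (g : ℝ) : ℝ := Real.exp (-g ^ 2 / (4 * a)) * (cslab coord (zrange 0 h)).card

omit [DecidableEq Λ] in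
/-- `ε_s ≥ 0`. [folklore] -/
theorem epsSpec_nonneg (g : ℝ) : 0 ≤ epsSpec coord a h g := by unfold epsSpec; positivity

/-- The real ground-state expectation `q̄ = Re ⟨ψ, Q̄ψ⟩`. [folklore] -/
def qbarRe (ψ : TensorIndex Λ 2 → ℂ) : ℝ := (star ψ ⬝ᵥ (qBar coord Φ r₀ a h r *ᵥ ψ)).re

/-- The distance `D = min(L - h - 2r₀ - 2m, h - 4r₀ - 2m)` between the strips in the coordinate
direction. [folklore] -/
def stripDist (L r₀ h m : ℕ) : ℕ := min (L - h - 2 * r₀ - 2 * m) (h - 4 * r₀ - 2 * m)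

/-- **The clustering constant of the strip pair** `(S₋, S₊)` (the constant of `coord_clustering` at
distance `stripDist`): `(2 + 4J + 8(r₀+1)/v·… + 8v/g) max(|slab S₋|,|slab S₊|) e^{-(D - r₀)/ξ}`.
[folklore] -/
def clustK (g : ℝ) : ℝ :=
  (2 + 4 * J + 4 * 2 / (lrVelocity r₀ V J * (1 / ((r₀ : ℝ) + 1))) + 8 * lrVelocity r₀ V J / g) *
    ((max (cslab coord (stripM r₀ m)).card (cslab coord (stripP r₀ h m)).card : ℕ) : ℝ) *
    Real.exp (-((stripDist L r₀ h m : ℕ) - (r₀ : ℝ)) / max (8 / (1 / ((r₀ : ℝ) + 1))) (4 * lrVelocity r₀ V J / g))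

end Quantities

section Analysis

variable {coord f Φ r₀ V J a h m r} {g : ℝ} {ψ : TensorIndex Λ 2 → ℂ}

local notation "𝔖" => Setting coord f Φ r₀ V J a h m r g ψ

/-- `Q̄` is Hermitian. [folklore] -/
theorem isHermitian_qBar (hs : 𝔖) : (qBar coord Φ r₀ a h r).IsHermitian :=
  ((regionCharge_isHermitian _).sub (isHermitian_kLocG hs.coordLocal.isLocal a _ _ _)).sub
    (isHermitian_kLocG hs.coordLocal.isLocal a _ _ _)

local notation "QΓ" => regionCharge (cslab coord (zrange 0 h))
local notation "QB" => qBar coord Φ r₀ a h r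
local notation "KM" => kM coord Φ r₀ a h r
local notation "KP" => kP coord Φ r₀ a h r
local notation "KTM" => kTM coord Φ r₀ a h
local notation "KTP" => kTP coord Φ r₀ a h
local notation "VV" => (transV f : Op Λ 2)
local notation "δK" => deltaK coord Φ r₀ a h r
local notation "εs" => epsSpec coord a h g
local notation "q̄" => qbarRe coord Φ r₀ a h r ψ

/-- `⟨ψ, Q̄ψ⟩ = q̄` (real). [folklore] -/
theorem expect_qBar_eq (hs : 𝔖) : star ψ ⬝ᵥ (QB *ᵥ ψ) = ((q̄ : ℝ) : ℂ) :=
  expect_eq_re_of_isHermitian (isHermitian_qBar hs) ψ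

/-- **BBDF Lemma 4.4 (variance of `Q̄`), Gaussian version**: `‖(Q̄ - q̄)ψ‖₂ ≤ 2δ_K + ε_s`, since
`ψ` is an approximate eigenvector of `Q̃ = Q - K̃₋ - K̃₊` (error `ε_s`) and `‖Q̄ - Q̃‖ ≤ δ_K`.
[cite: BachmannEtAl2019, Lemma 4.4] -/
theorem eucNorm_qBar_sub_le [NeZero L] (hs : 𝔖) : eucNorm (QB *ᵥ ψ - ((q̄ : ℝ) : ℂ) • ψ) ≤ 2 * δK + εs := by
  have hΦ := hs.coordLocal.isLocal
  -- the approximate eigenvector property of `Q̃`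
  have happ := eucNorm_regionCharge_sub_kTildeG_mulVec_le hΦ hs.u1 (S := cslab coord (zrange 0 h))
    (disjoint_cslab_win hs) (crossingTerms_subset_windows hs) hs.gap_pos le_rfl hs.a_pos hs.gap hs.ground hs.unit
  set Qt := QΓ - KTM - KTP with hQt
  set qt : ℂ := star ψ ⬝ᵥ (Qt *ᵥ ψ) with hqt
  have happ' : eucNorm (Qt *ᵥ ψ - qt • ψ) ≤ εs := happ
  -- `Q̄ - Q̃ = (K̃₋ - K₋) + (K̃₊ - K₊)`
  have hdiff : QB - Qt = (KTM - KM) + (KTP - KP) := by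
    rw [hQt, qBar, kTM, kTP]; abel
  have hnd : ‖QB - Qt‖ ≤ δK := by
    rw [hdiff, deltaK]
    refine (norm_add_le _ _).trans (add_le_add ?_ ?_) <;> rw [norm_sub_rev]
  -- decomposition of `(Q̄ - q̄)ψ`
  have hq : ((q̄ : ℝ) : ℂ) = star ψ ⬝ᵥ (QB *ᵥ ψ) := (expect_qBar_eq hs).symm
  have hdec : QB *ᵥ ψ - ((q̄ : ℝ) : ℂ) • ψ =
      (QB - Qt) *ᵥ ψ + (Qt *ᵥ ψ - qt • ψ) + (qt - star ψ ⬝ᵥ (QB *ᵥ ψ)) • ψ := by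
    rw [hq, sub_mulVec, sub_smul]
    abel
  rw [hdec]
  have h1 : eucNorm ((QB - Qt) *ᵥ ψ) ≤ δK := by
    refine (eucNorm_mulVec_le _ _).trans ?_
    rw [eucNorm_eq_one hs.unit, mul_one]; exact hnd
  have h2 : ‖qt - star ψ ⬝ᵥ (QB *ᵥ ψ)‖ ≤ δK := by
    have e : qt - star ψ ⬝ᵥ (QB *ᵥ ψ) = star ψ ⬝ᵥ ((Qt - QB) *ᵥ ψ) := by
      rw [hqt, ← dotProduct_sub, ← sub_mulVec]
    rw [e]
    refine (norm_vectorState_le hs.unit (Qt - QB)).trans ?_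
    rw [norm_sub_rev]; exact hnd
  calc eucNorm ((QB - Qt) *ᵥ ψ + (Qt *ᵥ ψ - qt • ψ) + (qt - star ψ ⬝ᵥ (QB *ᵥ ψ)) • ψ)
      ≤ eucNorm ((QB - Qt) *ᵥ ψ + (Qt *ᵥ ψ - qt • ψ)) + eucNorm ((qt - star ψ ⬝ᵥ (QB *ᵥ ψ)) • ψ) :=
        eucNorm_add_le _ _
    _ ≤ (eucNorm ((QB - Qt) *ᵥ ψ) + eucNorm (Qt *ᵥ ψ - qt • ψ)) + eucNorm ((qt - star ψ ⬝ᵥ (QB *ᵥ ψ)) • ψ) :=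
        add_le_add (eucNorm_add_le _ _) le_rfl
    _ ≤ (δK + εs) + δK := by
        refine add_le_add (add_le_add h1 happ') ?_
        rw [eucNorm_smul, eucNorm_eq_one hs.unit, mul_one]; exact h2
    _ = 2 * δK + εs := by ring

local notation "CK" => clustK (L := L) coord r₀ V J h m g

/-- `clustK ≥ 0`. [folklore] -/
theorem clustK_nonneg (hs : 𝔖) : 0 ≤ CK := by
  have hJ := hs.coordLocal.strength_nonneg
  have hv := lrVelocity_pos (r₀ := r₀) hJ hs.coordLocal.one_le_size
  have hg := hs.gap_pos
  unfold clustK; positivity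

/-- **Exponential clustering between the two strips** (BBDF Assumption (v) in the form used in
§4): for `A ∈ 𝔄(slab S₋)` and `B ∈ 𝔄(slab S₊)`, `|⟨ψ,ABψ⟩ - ⟨ψ,Aψ⟩⟨ψ,Bψ⟩| ≤ clustK ‖A‖ ‖B‖`,
provided the strips are far apart: `max(2v, 1) ≤ stripDist - r₀`.
[cite: BachmannEtAl2019, Assumption (v) and Proposition 2.4] -/
theorem strip_clustering [NeZero L] (hs : 𝔖)
    (hsep : max (2 * lrVelocity r₀ V J) 1 ≤ ((stripDist L r₀ h m : ℕ) : ℝ) - r₀)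
    {A B : Op Λ 2}
    (hA : A ∈ supportedSubalgebra (cslab coord (stripM r₀ m)))
    (hB : B ∈ supportedSubalgebra (cslab coord (stripP r₀ h m))) :
    ‖star ψ ⬝ᵥ ((A * B) *ᵥ ψ) - (star ψ ⬝ᵥ (A *ᵥ ψ)) * (star ψ ⬝ᵥ (B *ᵥ ψ))‖ ≤ CK * ‖A‖ * ‖B‖ := by
  have hge := hs.h_ge; have hle := hs.h_le; have h1 := hs.one_le_r₀
  have hAB : Commute A B := commute_of_mem_cslab hA hB (disjoint_stripP_stripM hs).symm
  -- nonempty strips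
  obtain ⟨x₀, hx₀⟩ := hs.surj (((L - r₀ - m : ℕ) : ZMod L))
  obtain ⟨y₀, hy₀⟩ := hs.surj (((h - 2 * r₀ - m : ℕ) : ZMod L))
  have hX : (cslab coord (stripM r₀ m)).Nonempty :=
    ⟨x₀, by rw [mem_cslab, hx₀]; exact mem_zrange.2 ⟨0, by omega, by rw [add_zero]⟩⟩
  have hY : (cslab coord (stripP r₀ h m)).Nonempty :=
    ⟨y₀, by rw [mem_cslab, hy₀]; exact mem_zrange.2 ⟨0, by omega, by rw [add_zero]⟩⟩
  have hD : ∀ x ∈ cslab coord (stripM r₀ m), ∀ y ∈ cslab coord (stripP r₀ h m),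
      stripDist L r₀ h m ≤ circDist (coord x) (coord y) := by
    intro x hx y hy
    rw [mem_cslab] at hx hy
    rw [circDist_comm]
    have := le_circDist_of_mem_zrange (a := h - 2 * r₀ - m) (n := 3 * r₀ + 2 * m + 1) (b := L - r₀ - m)
      (n' := 3 * r₀ + 2 * m + 1) (by omega) (by omega) hy hx
    refine le_trans (le_of_eq ?_) this
    unfold stripDist
    congr 1 <;> omega
  have key := coord_clustering hs.coordLocal hs.gap_pos hs.gap hs.ground hs.unit hA hB hAB hX hY hD hsep
  refine key.trans (le_of_eq ?_)
  unfold clustK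
  ring

local notation "QBM" => qBarM coord Φ r₀ a h m r
local notation "QMD" => qMid (L := L) coord r₀ h m
local notation "QBP" => qBarP coord Φ r₀ a h m r
local notation "QBMU" => qBarMU coord f Φ r₀ a h m r
local notation "QBPU" => qBarPU coord f Φ r₀ a h m r

/-- `Q̄₋` is Hermitian. [folklore] -/
theorem isHermitian_qBarM (hs : 𝔖) : (QBM).IsHermitian :=
  (regionCharge_isHermitian _).sub (isHermitian_kLocG hs.coordLocal.isLocal a _ _ _)

/-- `Q̄₊` is Hermitian. [folklore] -/
theorem isHermitian_qBarP (hs : 𝔖) : (QBP).IsHermitian :=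
  (regionCharge_isHermitian _).sub (isHermitian_kLocG hs.coordLocal.isLocal a _ _ _)

/-- `Q_m` is Hermitian. [folklore] -/
theorem isHermitian_qMid : (QMD).IsHermitian := regionCharge_isHermitian _

/-- `Q̄₋^U` is Hermitian. [folklore] -/
theorem isHermitian_qBarMU (hs : 𝔖) : (QBMU).IsHermitian :=
  (regionCharge_isHermitian _).sub (Matrix.isHermitian_mul_mul_conjTranspose _ (isHermitian_kLocG hs.coordLocal.isLocal a _ _ _))

/-- `Q̄₊^U` is Hermitian. [folklore] -/
theorem isHermitian_qBarPU (hs : 𝔖) : (QBPU).IsHermitian :=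
  (regionCharge_isHermitian _).sub (Matrix.isHermitian_mul_mul_conjTranspose _ (isHermitian_kLocG hs.coordLocal.isLocal a _ _ _))

/-! #### The operator `D₋ = Q̄₋^U - Q̄₋` and its expectation `-⟨Q_{[0]}⟩` -/

local notation "DM" => (qBarMU coord f Φ r₀ a h m r - qBarM coord Φ r₀ a h m r)
local notation "Q₀" => regionCharge (cslab coord (zrange 0 1))
local notation "ρ₀" => Complex.re (star ψ ⬝ᵥ (regionCharge (cslab coord (zrange 0 1)) *ᵥ ψ))

/-- `D₋ = -Q_{[0]} + (K₋ - VK₋Vᴴ)` (BBDF: `D₋ = T₋ + K₋ - U⋆K₋U`, `T₋ = -Q_{[0]}` for the translation).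
[cite: BachmannEtAl2019, Eq. (4.13) and §3.2] -/
theorem dM_eq (hs : 𝔖) : DM = -Q₀ + (KM - VV * KM * VVᴴ) := by
  have hle := hs.h_le; have hge := hs.h_ge
  have hz : (zrange 0 (2 * r₀ + m + 1) : Finset (ZMod L)) = zrange 0 1 ∪ zrange 1 (2 * r₀ + m) := by
    rw [show 2 * r₀ + m + 1 = 1 + (2 * r₀ + m) by omega, zrange_add, zero_add]
  have hd : Disjoint (zrange 0 1 : Finset (ZMod L)) (zrange 1 (2 * r₀ + m)) := disjoint_zrange_of_le (by omega) (by omega)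
  unfold qBarMU qBarM
  rw [hz, regionCharge_cslab_union hd]
  abel

/-- **`⟨D₋⟩ = ⟨T₋⟩ = -⟨Q_{[0]}⟩`** (BBDF (4.14): the `K`-terms cancel by the invariance of the state).
[cite: BachmannEtAl2019, Eq. (4.14)] -/
theorem expect_dM (hs : 𝔖) : star ψ ⬝ᵥ (DM *ᵥ ψ) = -(star ψ ⬝ᵥ (Q₀ *ᵥ ψ)) := by
  have hVK : star ψ ⬝ᵥ ((VV * KM * VVᴴ) *ᵥ ψ) = star ψ ⬝ᵥ (KM *ᵥ ψ) :=
    (expect_permOp_conj hs.gap f hs.symm hs.ground KM).1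
  rw [dM_eq hs, add_mulVec, neg_mulVec, sub_mulVec, dotProduct_add, dotProduct_neg, dotProduct_sub]
  unfold transV at hVK ⊢
  rw [hVK, sub_self, add_zero]

/-- Norm bound `‖D₋‖ ≤ |slab [0]| + 2‖K₋‖`. [folklore] -/
theorem norm_dM_le (hs : 𝔖) : ‖DM‖ ≤ (cslab coord (zrange 0 1)).card + 2 * ‖KM‖ := by
  rw [dM_eq hs]
  have hV : ‖VV‖ ≤ 1 := norm_le_one_of_conjTranspose_mul_self (conjTranspose_permOp_mul f)
  have hVh : ‖VVᴴ‖ ≤ 1 := by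
    refine norm_le_one_of_conjTranspose_mul_self ?_
    rw [conjTranspose_conjTranspose]; exact permOp_mul_conjTranspose f
  have hVKV : ‖VV * KM * VVᴴ‖ ≤ ‖KM‖ := by
    calc ‖VV * KM * VVᴴ‖ ≤ ‖VV‖ * ‖KM‖ * ‖VVᴴ‖ :=
          (norm_mul_le _ _).trans (mul_le_mul_of_nonneg_right (norm_mul_le _ _) (norm_nonneg _))
      _ ≤ 1 * ‖KM‖ * 1 := by gcongr
      _ = ‖KM‖ := by ring
  calc ‖-Q₀ + (KM - VV * KM * VVᴴ)‖ ≤ ‖-Q₀‖ + ‖KM - VV * KM * VVᴴ‖ := norm_add_le _ _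
    _ ≤ (cslab coord (zrange 0 1)).card + (‖KM‖ + ‖VV * KM * VVᴴ‖) := by
        rw [norm_neg]; exact add_le_add (norm_regionCharge_le _) (norm_sub_le _ _)
    _ ≤ (cslab coord (zrange 0 1)).card + 2 * ‖KM‖ := by linarith

/-- Norm bound `‖K₋‖ ≤ (√(π/a)/2) · 2V |slab W₋| J`. [folklore] -/
theorem norm_kM_le (hs : 𝔖) :
    ‖KM‖ ≤ Real.sqrt (Real.pi / a) / 2 * (2 * V * ((cslab coord (winM r₀)).card * J)) := by
  refine (norm_kLocG_le hs.coordLocal.isLocal hs.a_pos _ _ _).trans ?_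
  exact mul_le_mul_of_nonneg_left (norm_windowCurrent_le hs.coordLocal.isLocal hs.coordLocal.size hs.coordLocal.strength _ _)
    (by positivity)

/-- `V Q̄₋ Vᴴ = Q̄₋^U + Q_{[2r₀+m+1]}`. [cite: BachmannEtAl2019, Eq. (4.6)] -/
theorem transV_conj_qBarM (hs : 𝔖) :
    VV * QBM * VVᴴ = QBMU + regionCharge (cslab coord (zrange (2 * r₀ + m + 1) 1)) := by
  have hle := hs.h_le; have hge := hs.h_ge
  have hd : Disjoint (zrange 1 (2 * r₀ + m) : Finset (ZMod L)) (zrange (1 + (2 * r₀ + m)) 1) :=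
    disjoint_zrange_of_le (by omega) (by omega)
  unfold qBarM qBarMU
  rw [Matrix.mul_sub, Matrix.sub_mul, transV_conj_regionCharge_zrange hs, zero_add, zrange_add,
    regionCharge_cslab_union hd, show 1 + (2 * r₀ + m) = 2 * r₀ + m + 1 by omega]
  abel

/-- `Q̄₋^U` commutes with `Q_{[2r₀+m+1]}` (disjoint slabs). [folklore] -/
theorem commute_qBarMU_plane (hs : 𝔖) : Commute QBMU (regionCharge (cslab coord (zrange (2 * r₀ + m + 1) 1))) := by
  have hle := hs.h_le; have hge := hs.h_ge
  refine commute_of_mem_cslab (qBarMU_mem hs) (regionCharge_mem_supportedSubalgebra _) ?_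
  unfold stripM
  rw [← zrange_add_period (2 * r₀ + m + 1) 1]
  exact disjoint_zrange_of_le (by omega) (by omega)

/-- **`V e^{2πiQ̄₋} Vᴴ = e^{2πiQ̄₋^U}` exactly** (BBDF §4.4; here `e^{2πiQ_{[2r₀+m+1]}} = 1`).
[cite: BachmannEtAl2019, proof of Theorem 2.1 (§4.4)] -/
theorem transV_conj_exp_two_pi_qBarM (hs : 𝔖) :
    VV * NormedSpace.exp ((2 * Real.pi * I) • QBM) * VVᴴ = NormedSpace.exp ((2 * Real.pi * I) • QBMU) := by
  rw [transV_conj_exp, transV_conj_qBarM hs, smul_add,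
    Matrix.exp_add_of_commute _ _ (((commute_qBarMU_plane hs).smul_left _).smul_right _),
    exp_two_pi_I_smul_regionCharge, Matrix.mul_one]

/-! #### The index theorem for a strict translation symmetry -/

/-- **BBDF Theorem 2.1 with Proposition 2.4 for a strict one-step translation symmetry of a
spin-`1/2` system, with the Gaussian dressing, in quantitative form**: in the setting `Setting`,
if the strips are far apart (`max(2v,1) ≤ stripDist - r₀`), the ground-state expectation
`ρ₀ = ⟨ψ, Q_{slab [0]} ψ⟩` of the charge of one coordinate plane satisfies
`dist(ρ₀, ℤ) ≤ (2π((8πε + δ)‖D₋‖) + 2√(4πε + 2δ) + 4πε + 2δ)/4` with `ε = 2δ_K + ε_s` and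
`δ = clustK` — the abstract index theorem `exists_int_abs_expect_sub_le_of_exact_symmetry` (BBDF
§4) for the exact symmetry `Vᴴ`, fed with Lemma 4.4 (`eucNorm_qBar_sub_le`), Assumption (v)
(`strip_clustering`), `e^{2πiQ_m} = 1`, `V e^{2πiQ̄₋} Vᴴ = e^{2πiQ̄₋^U}` and `⟨D₋⟩ = -ρ₀`.
[cite: BachmannEtAl2019, Theorem 2.1, Proposition 2.4 and §4] -/
theorem exists_int_abs_expect_plane_sub_le [NeZero L] (hs : 𝔖)
    (hsep : max (2 * lrVelocity r₀ V J) 1 ≤ ((stripDist L r₀ h m : ℕ) : ℝ) - r₀) :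
    ∃ n : ℤ, |ρ₀ - n| ≤ (2 * Real.pi * ((8 * Real.pi * (2 * δK + εs) + CK) * ‖DM‖) +
        (2 * Real.sqrt (4 * Real.pi * (2 * δK + εs) + 2 * CK) + (4 * Real.pi * (2 * δK + εs) + 2 * CK))) / 4 := by
  have hδ := deltaK_nonneg coord Φ r₀ a h r
  have hεs := epsSpec_nonneg coord a h g
  obtain ⟨lam, -, -, hVh⟩ := exists_permOp_mulVec_eq_smul hs.gap f hs.symm hs.ground
  have hT : (VVᴴ)ᴴ * VVᴴ = 1 := by rw [conjTranspose_conjTranspose]; exact permOp_mul_conjTranspose f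
  have hTψ : VVᴴ *ᵥ ψ = lam⁻¹ • ψ := hVh
  have hSS : ∀ x ∈ supportedSubalgebra (cslab coord (stripM r₀ m)),
      ∀ y ∈ supportedSubalgebra (cslab coord (stripP r₀ h m)), Commute x y :=
    fun x hx y hy => commute_of_mem_cslab hx hy (disjoint_stripP_stripM hs).symm
  have hcl : ∀ x ∈ supportedSubalgebra (cslab coord (stripM r₀ m)),
      ∀ y ∈ supportedSubalgebra (cslab coord (stripP r₀ h m)),
      ‖star ψ ⬝ᵥ ((x * y) *ᵥ ψ) - (star ψ ⬝ᵥ (x *ᵥ ψ)) * (star ψ ⬝ᵥ (y *ᵥ ψ))‖ ≤ CK * ‖x‖ * ‖y‖ :=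
    fun x hx y hy => strip_clustering hs hsep hx hy
  have hmid_m : ∀ x ∈ supportedSubalgebra (cslab coord (stripM r₀ m)), Commute QMD x :=
    fun x hx => commute_of_mem_cslab qMid_mem hx (disjoint_stripM_mid hs).symm
  have hmid_p : ∀ y ∈ supportedSubalgebra (cslab coord (stripP r₀ h m)), Commute QMD y :=
    fun y hy => commute_of_mem_cslab qMid_mem hy (disjoint_mid_stripP hs)
  have hQ : eucNorm ((QBM + QMD + QBP) *ᵥ ψ - ((q̄ : ℝ) : ℂ) • ψ) ≤ 2 * δK + εs := by
    rw [← qBar_eq hs]; exact eucNorm_qBar_sub_le hs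
  have hQT : (VVᴴ)ᴴ * (QBM + QMD + QBP) * VVᴴ = QBMU + QMD + QBPU := by
    rw [conjTranspose_conjTranspose, ← qBar_eq hs]; exact transV_conj_qBar hs
  have hmid : NormedSpace.exp ((2 * Real.pi * I) • QMD) = 1 := exp_two_pi_I_smul_regionCharge _
  have hR4 : (VVᴴ)ᴴ * NormedSpace.exp ((2 * Real.pi * I) • QBM) * VVᴴ = NormedSpace.exp ((2 * Real.pi * I) • QBMU) := by
    rw [conjTranspose_conjTranspose]; exact transV_conj_exp_two_pi_qBarM hs
  obtain ⟨n, hn⟩ := exists_int_abs_expect_sub_le_of_exact_symmetry hs.unit hT hTψ hSS (clustK_nonneg hs) hcl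
    (isHermitian_qBarM hs) (isHermitian_qBarMU hs) (isHermitian_qBarP hs) (isHermitian_qBarPU hs) isHermitian_qMid
    (qBarM_mem hs) (qBarMU_mem hs) (qBarP_mem hs) (qBarPU_mem hs) hmid_m hmid_p (by positivity : (0 : ℝ) ≤ 2 * δK + εs)
    hQ hQT hmid hR4
  refine ⟨-n, ?_⟩
  have hre : (star ψ ⬝ᵥ ((QBMU - QBM) *ᵥ ψ)).re = -ρ₀ := by rw [expect_dM hs, Complex.neg_re]
  rw [hre] at hn
  have e : |ρ₀ - ((-n : ℤ) : ℝ)| = |-ρ₀ - n| := by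
    rw [Int.cast_neg, sub_neg_eq_add, ← abs_neg, neg_add, ← sub_eq_add_neg]
  rw [e]
  exact hn

end Analysis

end IndexSetting

end SpinLSM

end Literature.MathematicalPhysics.QuantumLattice

end
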